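import Summits.QuantumFields.BalabanUV.Beta.SpineRecursiveW
import Summits.QuantumFields.BalabanUV.Beta.SecondOrderStepRemainder
import Summits.QuantumFields.BalabanUV.Beta.VertexReflectionContact
import Summits.QuantumFields.BalabanUV.Beta.SpineRecursivePureParity
import Summits.QuantumFields.BalabanUV.Beta.SecondOrderTransport
import Summits.QuantumFields.BalabanUV.Beta.WardLocusParitySplit
import Summits.QuantumFields.BalabanUV.Beta.GAN24.SecondOrderReadersParity

/-!
# `BalabanUV.Beta.GAN24.EvenTowerAutonomy` — binder row G-an2-4 ∕ (CONV-C), CT-W, the (α) exit «use the identity, not its defect» (RULING R-lead-g77-1 (2); OWNER gan24-p1 g33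
# RULING R-gan24p1-g33-1 (C1) ∕ -A1 (1) «p2 TYPE (3)»): **THE STEP SIDE OF THE AUTONOMY LEMMA — the resolvent-generic second bond-derivative read-out `e4OfKW Lc K S M W`
# is AFFINE in the carrier `W` with a SANDWICH dependence; the carrier-free double-response words are row-parity-EVEN; hence the EVEN half of the step's output depends on
# the carrier only through the carrier's EVEN half, and the ODD half of the carrier feeds only the ODD half of the output** (for a spread sgn-symmetric `K` and row-parity-odd
# first-order tables `S M`: the literal's `G_j = coDressKBmAt ρ Lc (KInvStep Lc j)`, `SpureRecAt … j`, `M1At … j`).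
# (G-an2-4 CRUX TEAM (2), seat `b2b-balaban-gan24-p2` = road-P2 chair, gen 44, INTENT 3)

NOT IN PRINT; OUR BOOKKEEPING ([folklore] kernel algebra BY NAME: an2's `BalabanStepW2.K3OfK` ∕ `SpineRooted.e4OfKW` (definitions), `SecondOrderResponse.K2OfK`, the tame calculus
`TameKernelCalculus.{comp_assoc_tame, comp_add_right_tame, comp_add_left_tame, comp_neg_left, comp_neg_right, trK_comp, Spr.comp_loc, Loc.comp_spr}`, the parity toolkit
`SpineRecursiveParity.{parityOdd_sandwich, parityOdd_mmRead, parityOdd_dM, parityOdd_smul, parityOdd_neg}`, `SecondOrderStepRemainder.parityEven_mmRead`, `BorderedHessian.comp_sgnK ∕ sgnK_sgnK ∕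
trK_sgnK`, `VertexReflectionContact.mmRead_add ∕ mmRead_neg`, leaf-03 g65 `GAN24.SecondOrderReadersParity.parityEven_evenHalf ∕ evenHalf_add_oddHalf`, d1-leaf-06 `WardLocusParitySplit.parityOdd_oddHalf`; 0 `def`, 0 cited fact, 0 `def … : Prop`, 0 sorry).
HONEST FRAMING (cell contract, verbatim): «discharging `BetaPertH` makes Bałaban's UV stability UNCONDITIONAL — a real constructive-QFT result; it is NOT the continuum limit and NOT
the Clay problem.»  HONEST DEPENDENCY (verbatim): «continuum YM on T⁴ ⇐ BetaPertH ∧ nine spine estimates (0/9 proved); BetaPertH ⇐ (D1) ∧ (D4) ∧ CAP+tail; G-an2-4 gates asym,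
D1 and NE2/3/4.»

WHY.  The D1 consumer reads the W-slot table only through `tadpole`, hence is blind to its row-parity-ODD half (OWNER g33 `WSlotParityBlind`); the Ward-locus residual — route «WC-TL»'s
(Q-R) object — is parity-odd at every level and the EVEN half of the W-table is Ward-EXACT (road-P2 g44 `WardResidualParity`).  For the (α) exit to close the W-slot WITHOUT (Q-R) the even
half must not be fed by the odd half along the recursion `T2RecOf (j+1) = (cE₂·wV4)•e4OfKW Lc G_j S_j M_j (W2SymOfK G_j Lc S_j M_j (T2RecOf j) (M2Of j)) + (cB·wB2)•vh₂S`
(`RecursiveWSlot.T2RecOf`).  The CARRIER side (`W2SymOfK` is parity-graded in its second-order slots) is leaf-03 g65's `SecondOrderCarrierParity`; THIS file is the STEP side: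
`e4OfKW Lc K S M W b b′ = mmRead Lc (K3OfK K Lc S M W b b′)`, `K3OfK K N S M W b b′ = −K∘dM(b)∘K2(b′) − K∘dM(b′)∘K2(b) − K∘W(b,b′)∘K`.
* §1 **`K3OfK_add_carrier`**, **`e4OfKW_add_carrier`** — AFFINE IN THE CARRIER: `e4OfKW Lc K S M (W + X) b b′ = e4OfKW Lc K S M W b b′ − mmRead Lc (K ∘ X b b′ ∘ K)` (spread `K`, localised slices).
* §2 **`parityEven_sandwich`** (the even twin of leaf-05's `parityOdd_sandwich`), **`parityEven_carrierTerm`** — the carrier term `mmRead Lc (K ∘ X ∘ K)` has the parity of `X`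
  (sgn-symmetric spread `K`; the odd case is leaf-05's `SecondOrderStepRemainder.parityOdd_mmRead_sandwich`, used BY NAME).
* §3 **`parityEven_doubleResponseWords`** — the carrier-free part `−K∘dM(b)∘K2(b′) − K∘dM(b′)∘K2(b)` is row-parity-EVEN when the rows of `S`, `M` are parity-odd (each word is the
  other's `sgnK∘trK`-image; three tame re-bracketings); hence **`parityEven_e4OfKW_of_parityEven_carrier`** and **`parityOdd_e4OfKW_carrier_only`**: for an EVEN carrier slice the whole
  read-out is even; for an ODD carrier slice the read-out is `(even words) − (odd sandwich)`.
* §4 **`evenHalf_e4OfKW_eq`** ∕ **`oddHalf_e4OfKW_eq`** — THE STEP-SIDE AUTONOMY: with `W b b′ = We + Wo`, `We` even, `Wo` odd (localised):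
  `½•(E + sgnK (trK E)) = e4OfKW Lc K S M We′ b b′` where `E = e4OfKW Lc K S M W b b′` and `We′` is ANY carrier family with `We′ b b′ = We` — the even half of the output IS the read-out
  of the even carrier; and `½•(E − sgnK (trK E)) = −mmRead Lc (K ∘ Wo ∘ K)` — the odd half of the output is the sandwich of the odd carrier ALONE (no double-response words).
* §5 (the literal, in-block root) `loc_halves`, **`evenHalf_T2RecAt_succ`** — for every carrier family `W′` whose `(μ,y;ν,y′)` slice is the EVEN HALF of `WrecAt … j μ y ν y′`:
  `½•(T2RecAt … (j+1) + sgnK∘trK∘T2RecAt … (j+1)) (μ,y;ν,y′) = (cE₂·wV4_{j+1}) • e4OfKW Lc G_j (SpureRecAt j) (M1At j) W′ μ y ν y′ + (cB·wB2_{j+1}) • ½•(vh₂S + sgnK∘trK∘vh₂S) (μ,y;ν,y′)`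
  — the even member one level up reads the W-carrier ONLY through its even half (one displayed hypothesis: `Loc` of the W-literal's slice, = `SpineRecursiveW.WrecAt_loc₂`);
  leaf-03 g65's `SecondOrderCarrierParity.evenHalf_WrecAt` gives that even half in closed form (a function of `T2RecAt^{ev}`, `M2Of^{ev}` and first-order data).
WHAT THIS DOES NOT DO: the carrier side (`W2SymOfK`'s parity grading — leaf-03 g65), the localisation of the literal's carrier slices (`SpineRecursiveW.WrecAt_loc₂`), the re-run of
(A-0) ∕ (U) ∕ SLAVE ∕ T-DL ∕ T-EQ on the even member (the OWNER's (α-END) `T2ShapeEvenEnd`); NOTHING of (Q-R) ∕ «T2Shape» ∕ (hW, hWall) discharged; (β) of record untouched;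
NEVER «G-an2-4 closed» as (CONV-C); NOT D1, NOT `BetaPertH`, NOT continuum, NOT Clay.  2026-08-23; no existing file touched.
-/

noncomputable section

open Finset
open scoped BigOperators
open Literature.MathematicalPhysics.QuantumFieldTheory
open Literature.MathematicalPhysics.QuantumFieldTheory.Balaban1983to89
open Literature.MathematicalPhysics.QuantumFieldTheory.Balaban1983to89.Beta
open ExpKernelCalculus (MKer comp)
open OneStepResolventKernel (Fib)
open SecondOrderResponse (dM K2OfK)
open BalabanStepJetsSucc (mmRead)
open BalabanStepW2 (K3OfK)
open Summit.QuantumFields.BalabanUV.Beta.TameKernelCalculus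
open Summit.QuantumFields.BalabanUV.Beta.BorderedHessian (sgnF sgnF_mul_self sgnK sgnK_apply sgnK_sgnK trK_sgnK comp_sgnK spr_sgnK)
open Summit.QuantumFields.BalabanUV.Beta.BubbleParity (sgnK_neg)
open Summit.QuantumFields.BalabanUV.Beta.KernelWardRemainderParity (sgnK_add parityOdd_add)
open Summit.QuantumFields.BalabanUV.Beta.SpineRecursiveParity (parityOdd_smul parityOdd_neg parityOdd_sandwich parityOdd_mmRead parityOdd_dM loc_sgnK)
open Summit.QuantumFields.BalabanUV.Beta.SecondOrderStepRemainder (parityEven_mmRead parityOdd_mmRead_sandwich)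
open Summit.QuantumFields.BalabanUV.Beta.VertexReflectionContact (mmRead_add mmRead_neg)
open Summit.QuantumFields.BalabanUV.Beta.SpineRooted (e4OfKW SpureRecAt M1At T2RecAt WrecAt T2RecAt_succ vertexFamily_M1At)
open AffineAveraging (box toSite)
open OneStepKernelFamily (KInvStep)
open BalabanStepW2 (wV4 wB2)
open Summit.QuantumFields.BalabanUV.Beta.AxialDressingRooted (coDressKBmAt)
open Summit.QuantumFields.BalabanUV.Beta.BubbleParity (trK_coDressKBmAt_KInvStep spr_of_decays)
open Summit.QuantumFields.BalabanUV.Beta.SpineRecursiveParity (trK_M1At sgnK_smul trK_smul)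
open Summit.QuantumFields.BalabanUV.Beta.SpineRecursivePureParity (trK_SpureRecAt decays_locStencil_common)
open Summit.QuantumFields.BalabanUV.Beta.SecondOrderTransport (loc_dM)
open Summit.QuantumFields.BalabanUV.Beta.WardLocusParitySplit (parityOdd_oddHalf sgnK_sub)
open Summit.QuantumFields.BalabanUV.Beta.GAN24.SecondOrderReadersParity (parityEven_evenHalf evenHalf_add_oddHalf)

namespace Summit.QuantumFields.BalabanUV.Beta.GAN24.EvenTowerAutonomy

variable {d : ℕ}

/-! ## §1 The read-out is affine in the carrier -/

/-- [folklore] `K2OfK K N S M b′ = −(K ∘ dM(b′) ∘ K)` as kernels (the definition, `funext`). -/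
theorem K2OfK_eq_neg_sandwich (K : MKer (d + 1) (Fib d)) (N : ℕ) (S M : Fin (d + 1) → (Fin (d + 1) → ℤ) → MKer (d + 1) (Fib d))
    (ν : Fin (d + 1)) (y' : Fin (d + 1) → ℤ) : K2OfK K N S M ν y' = -comp (comp K (dM K N S M ν y')) K := by
  funext x z a b
  rfl

/-- [folklore] `K3OfK` in kernel form: `−K∘dM(b)∘K2(b′) − K∘dM(b′)∘K2(b) − K∘W(b,b′)∘K` (the definition, `funext`). -/
theorem K3OfK_eq (K : MKer (d + 1) (Fib d)) (N : ℕ) (S M : Fin (d + 1) → (Fin (d + 1) → ℤ) → MKer (d + 1) (Fib d))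
    (W : Fin (d + 1) → (Fin (d + 1) → ℤ) → Fin (d + 1) → (Fin (d + 1) → ℤ) → MKer (d + 1) (Fib d))
    (μ : Fin (d + 1)) (y : Fin (d + 1) → ℤ) (ν : Fin (d + 1)) (y' : Fin (d + 1) → ℤ) :
    K3OfK K N S M W μ y ν y'
      = -comp (comp K (dM K N S M μ y)) (K2OfK K N S M ν y') - comp (comp K (dM K N S M ν y')) (K2OfK K N S M μ y)
          - comp (comp K (W μ y ν y')) K := by
  funext x z a b
  rfl

/-- NOT IN PRINT; OUR BOOKKEEPING.  **`K3OfK` IS AFFINE IN THE CARRIER**: for a spread `K` and localised carrier slices `W b b′`, `X b b′`,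
`K3OfK K N S M (W + X) b b′ = K3OfK K N S M W b b′ − K ∘ X b b′ ∘ K` (tame additivity of `comp`). -/
theorem K3OfK_add_carrier {K : MKer (d + 1) (Fib d)} (hK : Spr K) (N : ℕ) (S M : Fin (d + 1) → (Fin (d + 1) → ℤ) → MKer (d + 1) (Fib d))
    {W X : Fin (d + 1) → (Fin (d + 1) → ℤ) → Fin (d + 1) → (Fin (d + 1) → ℤ) → MKer (d + 1) (Fib d)}
    (μ : Fin (d + 1)) (y : Fin (d + 1) → ℤ) (ν : Fin (d + 1)) (y' : Fin (d + 1) → ℤ) (hW : Loc (W μ y ν y')) (hX : Loc (X μ y ν y')) :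
    K3OfK K N S M (W + X) μ y ν y' = K3OfK K N S M W μ y ν y' - comp (comp K (X μ y ν y')) K := by
  rw [K3OfK_eq, K3OfK_eq]
  have e : (W + X) μ y ν y' = W μ y ν y' + X μ y ν y' := rfl
  rw [e, comp_add_right_tame hK.tame hW.tame hX.tame, comp_add_left_tame (hK.comp_loc hW).tame (hK.comp_loc hX).tame hK.tame]
  abel

/-- NOT IN PRINT; OUR BOOKKEEPING.  **THE READ-OUT IS AFFINE IN THE CARRIER**: `e4OfKW Lc K S M (W + X) b b′ = e4OfKW Lc K S M W b b′ − mmRead Lc (K ∘ X b b′ ∘ K)`. -/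
theorem e4OfKW_add_carrier (Lc : ℕ) {K : MKer (d + 1) (Fib d)} (hK : Spr K) (S M : Fin (d + 1) → (Fin (d + 1) → ℤ) → MKer (d + 1) (Fib d))
    {W X : Fin (d + 1) → (Fin (d + 1) → ℤ) → Fin (d + 1) → (Fin (d + 1) → ℤ) → MKer (d + 1) (Fib d)}
    (μ : Fin (d + 1)) (y : Fin (d + 1) → ℤ) (ν : Fin (d + 1)) (y' : Fin (d + 1) → ℤ) (hW : Loc (W μ y ν y')) (hX : Loc (X μ y ν y')) :
    e4OfKW Lc K S M (W + X) μ y ν y' = e4OfKW Lc K S M W μ y ν y' - mmRead Lc (comp (comp K (X μ y ν y')) K) := by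
  unfold SpineRooted.e4OfKW
  rw [K3OfK_add_carrier hK Lc S M μ y ν y' hW hX, sub_eq_add_neg, mmRead_add, mmRead_neg, ← sub_eq_add_neg]

/-! ## §2 The carrier term has the parity of the carrier -/

/-- [folklore] **THE RESOLVENT SANDWICH OF A PARITY-EVEN KERNEL IS PARITY-EVEN** (the even twin of leaf-05's `parityOdd_sandwich`): spread sgn-symmetric `K`, localised `V` with
`trK V = sgnK V` ⇒ `trK (K ∘ V ∘ K) = sgnK (K ∘ V ∘ K)`. -/
theorem parityEven_sandwich {K V : MKer (d + 1) (Fib d)} (hKs : Spr K) (hVl : Loc V) (hKt : trK K = sgnK K) (hV : trK V = sgnK V) :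
    trK (comp (comp K V) K) = sgnK (comp (comp K V) K) := by
  rw [trK_comp, trK_comp, hKt, hV, comp_assoc_tame (spr_sgnK hKs).tame (loc_sgnK hVl).tame (spr_sgnK hKs).tame, comp_sgnK, comp_sgnK]

/-- NOT IN PRINT; OUR BOOKKEEPING.  **AN EVEN CARRIER SLICE GIVES AN EVEN CARRIER TERM**: `trK (mmRead Lc (K∘X∘K)) = sgnK (…)` for `trK X = sgnK X`. -/
theorem parityEven_carrierTerm (Lc : ℕ) {K X : MKer (d + 1) (Fib d)} (hKs : Spr K) (hKt : trK K = sgnK K) (hXl : Loc X) (hX : trK X = sgnK X) :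
    trK (mmRead Lc (comp (comp K X) K)) = sgnK (mmRead Lc (comp (comp K X) K)) :=
  parityEven_mmRead Lc (parityEven_sandwich hKs hXl hKt hX)

/-! ## §3 The carrier-free double-response words are parity-even -/

/-- NOT IN PRINT; OUR BOOKKEEPING.  **THE DOUBLE-RESPONSE WORDS ARE ROW-PARITY-EVEN**: for a spread sgn-symmetric `K` and LOCALISED parity-ODD first-order responses `D = dM(b)`,
`D′ = dM(b′)` (the literal's, by `parityOdd_dM`), the carrier-free part of `K3OfK`, `−K∘D∘K2(b′) − K∘D′∘K2(b) = K∘D∘(K∘D′∘K) + K∘D′∘(K∘D∘K)`, satisfies `trK = sgnK`: the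
`sgnK∘trK`-image of the first word is the second (`trK_comp`, `comp_sgnK`, three tame re-bracketings). -/
theorem parityEven_doubleResponseWords {K D D' : MKer (d + 1) (Fib d)} (hKs : Spr K) (hKt : trK K = sgnK K)
    (hDl : Loc D) (hD'l : Loc D') (hD : trK D = -sgnK D) (hD' : trK D' = -sgnK D') :
    trK (comp (comp K D) (comp (comp K D') K) + comp (comp K D') (comp (comp K D) K))
      = sgnK (comp (comp K D) (comp (comp K D') K) + comp (comp K D') (comp (comp K D) K)) := by
  -- the `sgnK ∘ trK` image of one word is the other
  have key : ∀ {A B : MKer (d + 1) (Fib d)}, Loc A → Loc B → trK A = -sgnK A → trK B = -sgnK B →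
      trK (comp (comp K A) (comp (comp K B) K)) = sgnK (comp (comp K B) (comp (comp K A) K)) := by
    intro A B hAl hBl hA hB
    have hKT : Tame K := hKs.tame
    rw [trK_comp, trK_comp, trK_comp, trK_comp, hKt, hA, hB]
    simp only [comp_neg_left, comp_neg_right, neg_neg]
    -- now the goal is `comp (comp sK (comp sB sK)) (comp sA sK) = sgnK (comp (comp K B) (comp (comp K A) K))`
    rw [comp_sgnK, comp_sgnK, comp_sgnK, comp_sgnK]
    have hKB : Loc (comp K B) := hKs.comp_loc hBl
    have hAK : Loc (comp A K) := hAl.comp_spr hKs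
    congr 1
    -- `(K ∘ (B ∘ K)) ∘ (A ∘ K) = (K ∘ B) ∘ ((K ∘ A) ∘ K)`
    rw [comp_assoc_tame hKT hBl.tame hKT, ← comp_assoc_tame hKB.tame hKT hAK.tame, comp_assoc_tame hKT hAl.tame hKT]
  rw [trK_add, sgnK_add, key hDl hD'l hD hD', key hD'l hDl hD' hD]
  exact add_comm _ _


/-! ## §4 The step-side autonomy: the even half of the read-out is the read-out of the even carrier; the odd half is the sandwich of the odd carrier -/

/-- [folklore] **THE READ-OUT = (DOUBLE-RESPONSE WORDS) − (CARRIER SANDWICH)**: with `D = dM K Lc S M b`, `D′ = dM K Lc S M b′`,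
`e4OfKW Lc K S M W b b′ = mmRead Lc (K∘D∘(K∘D′∘K) + K∘D′∘(K∘D∘K)) − mmRead Lc (K ∘ W b b′ ∘ K)` (definitions + `comp_neg_right`). -/
theorem e4OfKW_eq_words_sub_carrier (Lc : ℕ) (K : MKer (d + 1) (Fib d)) (S M : Fin (d + 1) → (Fin (d + 1) → ℤ) → MKer (d + 1) (Fib d))
    (W : Fin (d + 1) → (Fin (d + 1) → ℤ) → Fin (d + 1) → (Fin (d + 1) → ℤ) → MKer (d + 1) (Fib d))
    (μ : Fin (d + 1)) (y : Fin (d + 1) → ℤ) (ν : Fin (d + 1)) (y' : Fin (d + 1) → ℤ) :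
    e4OfKW Lc K S M W μ y ν y'
      = mmRead Lc (comp (comp K (dM K Lc S M μ y)) (comp (comp K (dM K Lc S M ν y')) K)
            + comp (comp K (dM K Lc S M ν y')) (comp (comp K (dM K Lc S M μ y)) K))
        - mmRead Lc (comp (comp K (W μ y ν y')) K) := by
  unfold SpineRooted.e4OfKW
  rw [K3OfK_eq, K2OfK_eq_neg_sandwich, K2OfK_eq_neg_sandwich, comp_neg_right, comp_neg_right, ← mmRead_sub']
  · congr 1
    abel
where
  /-- `mmRead` is subtractive. -/
  mmRead_sub' (Lc : ℕ) (F G : MKer (d + 1) (Fib d)) : mmRead Lc (F - G) = mmRead Lc F - mmRead Lc G := by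
    rw [sub_eq_add_neg, mmRead_add, mmRead_neg, ← sub_eq_add_neg]

/-- NOT IN PRINT; OUR BOOKKEEPING.  **THE STEP-SIDE AUTONOMY — EVEN HALF**: spread sgn-symmetric `K`, parity-odd rows `S M` with the two first responses `dM(b)`, `dM(b′)` localised,
a carrier slice `W b b′ = We + Wo` with `We` localised EVEN and `Wo` localised ODD.  Then for EVERY carrier family `W′` with `W′ b b′ = We`:
`½•(E + sgnK (trK E)) = e4OfKW Lc K S M W′ b b′`, `E := e4OfKW Lc K S M W b b′` — THE EVEN HALF OF THE STEP's OUTPUT IS THE STEP OF THE EVEN CARRIER (the odd carrier does not feed it). -/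
theorem evenHalf_e4OfKW_eq (Lc : ℕ) {K : MKer (d + 1) (Fib d)} (hKs : Spr K) (hKt : trK K = sgnK K)
    {S M : Fin (d + 1) → (Fin (d + 1) → ℤ) → MKer (d + 1) (Fib d)}
    (hS : ∀ κ u, trK (S κ u) = -sgnK (S κ u)) (hM : ∀ ρ w, trK (M ρ w) = -sgnK (M ρ w))
    {W W' : Fin (d + 1) → (Fin (d + 1) → ℤ) → Fin (d + 1) → (Fin (d + 1) → ℤ) → MKer (d + 1) (Fib d)} {We Wo : MKer (d + 1) (Fib d)}
    (μ : Fin (d + 1)) (y : Fin (d + 1) → ℤ) (ν : Fin (d + 1)) (y' : Fin (d + 1) → ℤ)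
    (hDl : Loc (dM K Lc S M μ y)) (hD'l : Loc (dM K Lc S M ν y'))
    (hW : W μ y ν y' = We + Wo) (hW' : W' μ y ν y' = We) (hWel : Loc We) (hWol : Loc Wo) (hWe : trK We = sgnK We) (hWo : trK Wo = -sgnK Wo) :
    (1 / 2 : ℝ) • (e4OfKW Lc K S M W μ y ν y' + sgnK (trK (e4OfKW Lc K S M W μ y ν y'))) = e4OfKW Lc K S M W' μ y ν y' := by
  have hD := parityOdd_dM K Lc hS hM μ y
  have hD' := parityOdd_dM K Lc hS hM ν y'
  have hwords := parityEven_mmRead Lc (parityEven_doubleResponseWords hKs hKt hDl hD'l hD hD')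
  have hce := parityEven_carrierTerm Lc hKs hKt hWel hWe
  have hco := parityOdd_mmRead_sandwich Lc hKs hKt hWol hWo
  have hsplit : mmRead Lc (comp (comp K (We + Wo)) K) = mmRead Lc (comp (comp K We) K) + mmRead Lc (comp (comp K Wo) K) := by
    rw [comp_add_right_tame hKs.tame hWel.tame hWol.tame, comp_add_left_tame (hKs.comp_loc hWel).tame (hKs.comp_loc hWol).tame hKs.tame, mmRead_add]
  rw [e4OfKW_eq_words_sub_carrier, e4OfKW_eq_words_sub_carrier, hW, hW', hsplit, trK_sub, trK_add, hwords, hce, hco]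
  have e : ∀ A B C : MKer (d + 1) (Fib d), sgnK (sgnK A - (sgnK B + -sgnK C)) = A - (B - C) := fun A B C => by
    funext x z a b
    simp only [sgnK_apply, Pi.sub_apply, Pi.add_apply, Pi.neg_apply]
    have h2 : sgnF a * sgnF b * (sgnF a * sgnF b) = 1 := by
      rw [mul_mul_mul_comm, sgnF_mul_self, sgnF_mul_self, one_mul]
    linear_combination (A x z a b - (B x z a b - C x z a b)) * h2
  rw [e]
  have e2 : ∀ A B C : MKer (d + 1) (Fib d), A - (B + C) + (A - (B - C)) = (2 : ℝ) • (A - B) := fun A B C => by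
    rw [two_smul]; abel
  rw [e2, smul_smul]
  norm_num

/-- NOT IN PRINT; OUR BOOKKEEPING.  **THE STEP-SIDE AUTONOMY — ODD HALF**: under the same hypotheses, `½•(E − sgnK (trK E)) = −mmRead Lc (K ∘ Wo ∘ K)` — THE ODD HALF OF THE STEP's
OUTPUT IS THE SANDWICH OF THE ODD CARRIER ALONE (no double-response word, no even carrier). -/
theorem oddHalf_e4OfKW_eq (Lc : ℕ) {K : MKer (d + 1) (Fib d)} (hKs : Spr K) (hKt : trK K = sgnK K)
    {S M : Fin (d + 1) → (Fin (d + 1) → ℤ) → MKer (d + 1) (Fib d)}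
    (hS : ∀ κ u, trK (S κ u) = -sgnK (S κ u)) (hM : ∀ ρ w, trK (M ρ w) = -sgnK (M ρ w))
    {W : Fin (d + 1) → (Fin (d + 1) → ℤ) → Fin (d + 1) → (Fin (d + 1) → ℤ) → MKer (d + 1) (Fib d)} {We Wo : MKer (d + 1) (Fib d)}
    (μ : Fin (d + 1)) (y : Fin (d + 1) → ℤ) (ν : Fin (d + 1)) (y' : Fin (d + 1) → ℤ)
    (hDl : Loc (dM K Lc S M μ y)) (hD'l : Loc (dM K Lc S M ν y'))
    (hW : W μ y ν y' = We + Wo) (hWel : Loc We) (hWol : Loc Wo) (hWe : trK We = sgnK We) (hWo : trK Wo = -sgnK Wo) :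
    (1 / 2 : ℝ) • (e4OfKW Lc K S M W μ y ν y' - sgnK (trK (e4OfKW Lc K S M W μ y ν y'))) = -mmRead Lc (comp (comp K Wo) K) := by
  have hD := parityOdd_dM K Lc hS hM μ y
  have hD' := parityOdd_dM K Lc hS hM ν y'
  have hwords := parityEven_mmRead Lc (parityEven_doubleResponseWords hKs hKt hDl hD'l hD hD')
  have hce := parityEven_carrierTerm Lc hKs hKt hWel hWe
  have hco := parityOdd_mmRead_sandwich Lc hKs hKt hWol hWo
  have hsplit : mmRead Lc (comp (comp K (We + Wo)) K) = mmRead Lc (comp (comp K We) K) + mmRead Lc (comp (comp K Wo) K) := by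
    rw [comp_add_right_tame hKs.tame hWel.tame hWol.tame, comp_add_left_tame (hKs.comp_loc hWel).tame (hKs.comp_loc hWol).tame hKs.tame, mmRead_add]
  rw [e4OfKW_eq_words_sub_carrier, hW, hsplit, trK_sub, trK_add, hwords, hce, hco]
  have e : ∀ A B C : MKer (d + 1) (Fib d), sgnK (sgnK A - (sgnK B + -sgnK C)) = A - (B - C) := fun A B C => by
    funext x z a b
    simp only [sgnK_apply, Pi.sub_apply, Pi.add_apply, Pi.neg_apply]
    have h2 : sgnF a * sgnF b * (sgnF a * sgnF b) = 1 := by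
      rw [mul_mul_mul_comm, sgnF_mul_self, sgnF_mul_self, one_mul]
    linear_combination (A x z a b - (B x z a b - C x z a b)) * h2
  rw [e]
  have e2 : ∀ A B C : MKer (d + 1) (Fib d), A - (B + C) - (A - (B - C)) = (2 : ℝ) • (-C) := fun A B C => by
    rw [two_smul]; abel
  rw [e2, smul_smul, smul_neg]
  norm_num


/-! ## §5 The literal: the even half of the comb member one level up is the step of the even half of the W-carrier -/

section Literal

variable {Lc : ℕ} [NeZero Lc]

/-- [folklore] The two halves of a localised kernel are localised. -/
theorem loc_halves {L : MKer (d + 1) (Fib d)} (h : Loc L) :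
    Loc (((1 : ℝ) / 2) • (L + sgnK (trK L))) ∧ Loc (((1 : ℝ) / 2) • (L - sgnK (trK L))) :=
  ⟨(h.add (loc_sgnK h.trK)).smul _, (h.sub (loc_sgnK h.trK)).smul _⟩

/-- NOT IN PRINT; OUR BOOKKEEPING.  **THE LITERAL's AUTONOMY STEP** (in-block root `toSite r`, all `cE cVH cΛ cE₂ cB T vh₂S mixFF`, every level `j` and slot pair; the ONE displayed
hypothesis `hWl` = the localisation of the W-literal's slice, which `SpineRecursiveW.WrecAt_loc₂` supplies under the border∕mixed binders `hB hmix`): for EVERY carrier family `W′`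
whose `(μ,y;ν,y′)` slice is the EVEN HALF of `WrecAt … j μ y ν y′`,
`½•(T̃_{j+1} + sgnK (trK T̃_{j+1})) (μ,y;ν,y′) = (cE₂·wV4_{j+1}) • e4OfKW Lc G_j S_j M_j W′ μ y ν y′ + (cB·wB2_{j+1}) • ½•(vh₂S + sgnK∘trK∘vh₂S) (μ,y;ν,y′)`,
`T̃ = T2RecAt …`, `G_j = coDressKBmAt (toSite r) Lc (KInvStep Lc j)`, `S_j = SpureRecAt … j`, `M_j = M1At … j` — THE EVEN MEMBER ONE LEVEL UP READS THE W-CARRIER ONLY THROUGH ITS EVEN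
HALF (§4 at the literal: `G_j` spread ∕ sgn-symmetric — an2; `S_j`, `M_j` row-parity-odd — d1-formalise-leaf-05; `dM G_j Lc S_j M_j b` localised — `SecondOrderTransport.loc_dM` at
the common rate of `decays_locStencil_common`).  With leaf-03 g65's carrier formula (`SecondOrderCarrierParity`: the even half of `W2SymOfK[T₂, M₂]` is a function of `T₂^{ev}`,
`M₂^{ev}` and first-order data) this is the autonomy of the even sub-recursion (OWNER RULING R-gan24p1-g33-1 (C1)); the (α-END) assembles. -/
theorem evenHalf_T2RecAt_succ (hLc : 1 ≤ Lc) {r : Fin (d + 1) → ℕ} (hr : r ∈ box (d + 1) Lc) (cE cVH cΛ cE₂ cB : ℝ)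
    (T : Fin 4 → Fin 4 → Fin 4 → Fin 4 → ℝ) (vh₂S mixFF : Fin (d + 1) → (Fin (d + 1) → ℤ) → Fin (d + 1) → (Fin (d + 1) → ℤ) → MKer (d + 1) (Fib d))
    (j : ℕ) (μ : Fin (d + 1)) (y : Fin (d + 1) → ℤ) (ν : Fin (d + 1)) (y' : Fin (d + 1) → ℤ)
    (hWl : Loc (WrecAt d Lc (toSite r) cE cVH cΛ cE₂ cB T vh₂S mixFF j μ y ν y'))
    {W' : Fin (d + 1) → (Fin (d + 1) → ℤ) → Fin (d + 1) → (Fin (d + 1) → ℤ) → MKer (d + 1) (Fib d)}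
    (hW' : W' μ y ν y' = ((1 : ℝ) / 2) • (WrecAt d Lc (toSite r) cE cVH cΛ cE₂ cB T vh₂S mixFF j μ y ν y'
        + sgnK (trK (WrecAt d Lc (toSite r) cE cVH cΛ cE₂ cB T vh₂S mixFF j μ y ν y')))) :
    ((1 : ℝ) / 2) • (T2RecAt d Lc (toSite r) cE cVH cΛ cE₂ cB T vh₂S mixFF (j + 1) μ y ν y'
        + sgnK (trK (T2RecAt d Lc (toSite r) cE cVH cΛ cE₂ cB T vh₂S mixFF (j + 1) μ y ν y')))
      = (cE₂ * wV4 d Lc (j + 1)) •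
          e4OfKW Lc (coDressKBmAt (toSite r) Lc (KInvStep (d := d) Lc j)) (SpureRecAt d Lc (toSite r) cE cVH cΛ j) (M1At d Lc (toSite r) cΛ j) W' μ y ν y'
        + (cB * wB2 d Lc (j + 1)) • (((1 : ℝ) / 2) • (vh₂S μ y ν y' + sgnK (trK (vh₂S μ y ν y')))) := by
  -- the literal's inputs to §4
  obtain ⟨m, C, Cs, hm, hC, hG, hS⟩ := decays_locStencil_common (d := d) hLc hr cE cVH cΛ j
  have hspr : Spr (coDressKBmAt (toSite r) Lc (KInvStep (d := d) Lc j)) := spr_of_decays ⟨m, C, hm, hC, hG⟩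
  have hGt := trK_coDressKBmAt_KInvStep (d := d) hr j
  have hSp := trK_SpureRecAt (d := d) hLc hr cE cVH cΛ j
  have hMp : ∀ ρ w, trK (M1At d Lc (toSite r) cΛ j ρ w) = -sgnK (M1At d Lc (toSite r) cΛ j ρ w) := fun ρ w => trK_M1At (toSite r) cΛ j ρ w
  have hMv := vertexFamily_M1At (d := d) hLc hr cΛ j hm.le
  have hDl : ∀ (b : Fin (d + 1)) (c : Fin (d + 1) → ℤ),
      Loc (dM (coDressKBmAt (toSite r) Lc (KInvStep (d := d) Lc j)) Lc (SpureRecAt d Lc (toSite r) cE cVH cΛ j) (M1At d Lc (toSite r) cΛ j) b c) :=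
    fun b c => loc_dM hG hC hS hMv hm le_rfl b c
  obtain ⟨hWel, hWol⟩ := loc_halves hWl
  have hsplit := (evenHalf_add_oddHalf (WrecAt d Lc (toSite r) cE cVH cΛ cE₂ cB T vh₂S mixFF j μ y ν y')).symm
  have key := evenHalf_e4OfKW_eq Lc hspr hGt hSp hMp μ y ν y' (hDl μ y) (hDl ν y') hsplit hW' hWel hWol
    (parityEven_evenHalf _) (parityOdd_oddHalf _)
  rw [T2RecAt_succ]
  simp only []
  rw [← key, trK_add, trK_smul, trK_smul, sgnK_add, sgnK_smul, sgnK_smul]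
  simp only [smul_add, smul_smul, mul_comm ((1 : ℝ) / 2)]
  abel

end Literal


end Summit.QuantumFields.BalabanUV.Beta.GAN24.EvenTowerAutonomy

end
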